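import Summits.HubbardSuperconductivity.HubbardSuperconductivity.Theorems.AnisotropyChordTransferFibre3B1Bracket
import Summits.HubbardSuperconductivity.HubbardSuperconductivity.Theorems.AnisotropyChordTransferFibre3KT1Targets

/-!
# Route `AnisotropyChord` / H0 rotor rung: PORT PartN41-B — the `N₁` row of the LEVEL-2 certificate (piece A, `∀ L ≥ 128`):
named sums, closed expansions, outer-tail majorants, assembly

Port (verbatim modulo this header and the port comment) of the theory seat's statement file
`hubbard-h0-rotor-theory-1/cycle22/lean/PartN41B.lean` (sha16 `c7018b4c2cca2022`; theory seat `hubbard-h0-rotor-theory-1`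
g22, REPORT 1 = FINAL 2026-08-30T03:45:31Z, memo ROTOR-THEORY-22 §333–§336, cycle22/lean/PORT-INDEX.md).  Statements only
(`def`s = Level-2 objects, `def … : Prop` = TARGETS; the typed source proves nothing here).  The named sums of §3 are
instances of `B1.torSum` (`…Fibre3B1Objects`) and their brackets `NamedSumBrackets` / `TxBracket` are discharged in the
sibling `…Fibre3N1RowBrackets` (p2 g4: `B1.b1Bracket`, `B1.b1Bracket_weighted`); §7's `TplusFromPC0` / `N1FromPieces`
contents are landed by p1 g26 (`KT1Assembly.Tplus_bracket`, `KT1Assembly.n1_ge_pieces`).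
Prover seat `hubbard-h0-rotor-p2` g4; helper for piece A = stmt-HubbardSuperconductivity-23918 of rung 19089
(`--supports`, helper class).  WHAT THIS IS NOT: nothing here proves superconductivity in the Hubbard model; these are
helper statements of ONE conditional reduction (the GM₃ ∀L certificate, Level-2 row `N₁`); the rotor TARGET as originally
worded stays FALSE (g15 verdict).  Mathlib + tree imports only; no sorry, no axioms.

Theory seat's own summary of the file:

# PartN41-B — the `N₁` row of the LEVEL-2 certificate (piece A, `∀ L ≥ 128`): named sums, closed expansions,
outer-tail majorants, assembly (theory-1 g22, memo 22 §333–§336; LEVEL2-SPEC §6 items 1–4)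

STATEMENT FILE (definitions + `Prop` targets, no proofs).  The objects of the `N₁` identity
(`N1Identity`, proved: `n1Identity_holds`) — `B = Bterm`, `‖Π⁰‖² = PiNormSq`, `A(x̂) = Axhat`, `⟨Π⁰,C0⟩`, `B_C = BCterm` —
are one-loop momentum sums (`BtermOneLoop`, `PiNormOneLoop`, `AxhatOneLoop`, `PiC0OneLoop`, `BCOneLoop`, all proved) of
`F₂(k)` and `φ̂_e(k)`.  LEVEL 2 (memo 22 §334) writes, for `k ≠ 0`,
`F₂(k) = c(k) + t(k)`, `c(k) := −(2c_s g(k) + d)` CLOSED (`g = gres`, `c_s = cS`, `d = a²`, `a = Δf_nn`), `t = tfun` the tail;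
`φ̂_e(k) = μ_e(k) + ½(1 − e^{−ik·e}) t(k) + ½ τ_e(k)`, `μ_e` CLOSED, `τ_e = tauC` the gradient tail; and splits momentum space into
 * the NAMED set `|q|∞ ≤ 1` (there `t`, `τ_e` are the named two-propagator sums `T10, T11, Tx10, Tx11` + closed terms:
   `TfunNamed`, `TauNamed`),
 * a finite BLOCK `|q|∞ ≤ M₂` (pair objects: `−M₂−1 ≤ q₁ ≤ M₂`), treated per momentum with the T3 intervals
   `t(q) ∈ [t⁻(q), min(‖s‖², κ_q)]` (`TtailBounds`, proved) and `|τ_e(q)| ≤ τ̄` (`TauTailBoundC` below; real part proved as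
   `TauTailBound`),
 * the OUTER region, where the closed part is summed in closed form (§5: polynomial identities in the NAMED one-loop sums
   `S₂,S₃,S₄,T10,G21,G12,G22,G31,G13` and the gap-equation value `c_s S₁ = V − a(V−1)`) and everything carrying a tail factor is
   majorised termwise using `|t(q)| ≤ κ̂ g(q)` (`κ̂ = 4c_s²G̃(0)ρ_{M₂}`) and `|τ_e| ≤ τ̄` (§6: `…OuterBound`); every majorant is again
   a polynomial in `g, g′, E, E′`, i.e. (full named sums) − (block part).
Every named sum is an instance of p2's generic B1 bracket `B1.b1Bracket` (`θ₀ = 2π/128`, `K = 32`; §3 records the instances and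
the cos-weighted variant `TxBracket`), so the whole row is an explicit function of the cell variables `(θ = 2π/L, ν, a)` and of
bracketed named sums — LEVEL2-SPEC item 5 (cell arithmetic) evaluates it.  NUMBERS (cycle22/calc/level2_N1.py, exact torus sums
vs. this structure, `M₂ = 6`, `m₀ = 1.3`): `L = 128`: `c₁″` truth .6072/.6169/.6551 (Δ = .1/.5/.95), LEVEL-2 lower bound
.5853/.6069/.6547 (loss .022/.010/.0004), with every named sum moved to its worse B1-bracket end .5825/.6055 (loss .025/.011);
certificate margins at L = 128 stay ≥ +.40.  `L = 64`: loss .035 (so `L₀ = 64` is also affordable for this row).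

Conventions: `V = L²`, `θ = 2π/L`, `λ₂ = νθ²`, `E(k) := 2ε_T(k)` (so `E g = 1 + λ₂ g` off `k = 0`), `k′ := k + K₁`,
`T′ := (ℤ/L)² ∖ {0, −K₁}`.  All sums are over `Tor L` unless a `Finset` is given.
-/

-- Port of theory seat `hubbard-h0-rotor-theory-1` cycle22/lean/PartN41B.lean (sha16 c7018b4c2cca2022) verbatim modulo the
-- header; prover seat `hubbard-h0-rotor-p2` g4, `--supports stmt-HubbardSuperconductivity-23918`.

set_option linter.dupNamespace false
set_option autoImplicit false

noncomputable section

open scoped BigOperators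
open Complex

namespace Summit.HubbardSuperconductivity.HubbardSuperconductivity.Theorems.AnisotropyChord.Transfer.Fibre3

variable (L : ℕ) [NeZero L]

/-! ## §1 Scalars on the solution manifold and the closed per-momentum parts -/

/-- `a := Δ f_nn` (the contact weight; `Δf_nn² = a·f_nn`, `q := Δf_nn²(Δ + 2η) = a² + 2π²ν a`). -/
def aPar (Δ : ℝ) (f : Tor L → ℝ) : ℝ := Δ * f (K1 L)

/-- `d := a²`. -/
def dPar (Δ : ℝ) (f : Tor L → ℝ) : ℝ := (Δ * f (K1 L)) ^ 2

/-- `q := Δ f_nn² (Δ + 2(1 − Δ))` (the coefficient of the `(1 + e^{−ik·e})/2` part of `μ_e`). -/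
def qPar (Δ : ℝ) (f : Tor L → ℝ) : ℝ := Δ * f (K1 L) ^ 2 * (Δ + 2 * (1 - Δ))

/-- `‖s‖² = Σ_r s(r)²` (`= t(0)`). -/
def sNormSq (Δ : ℝ) (f : Tor L → ℝ) : ℝ := ∑ r : Tor L, sfun' L Δ f r ^ 2

/-- `F₂(0) = V + ‖h‖²`, `‖h‖² = 1 + ‖s‖² − (1 − a)²`. -/
def nf2V (Δ : ℝ) (f : Tor L → ℝ) : ℝ := (L : ℝ) ^ 2 + 1 + sNormSq L Δ f - (1 - aPar L Δ f) ^ 2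

/-- `τ̄ := ‖D_e s‖² = 2η_eff(1 − a + ‖h‖²/V)` (closed, `GradSNormClosed`, proved; the same for the four `e`). -/
def tauBar (Δ lam2 : ℝ) (f : Tor L → ℝ) : ℝ :=
  2 * etaEff L lam2 * (1 - aPar L Δ f + (1 + sNormSq L Δ f - (1 - aPar L Δ f) ^ 2) / (L : ℝ) ^ 2)

/-- `γ := φ̂_e(0) = λ₂ F₂(0)/4 + Δ f_nn²`. -/
def gamPar (Δ lam2 : ℝ) (f : Tor L → ℝ) : ℝ := lam2 * nf2V L Δ f / 4 + Δ * f (K1 L) ^ 2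

/-- the closed part of `F₂(k)`, `k ≠ 0`: `c(k) = −(2c_s g(k) + d)`. -/
def cK (Δ lam2 : ℝ) (f : Tor L → ℝ) (k : Tor L) : ℝ := -(2 * cS L Δ lam2 f * gres L lam2 k + dPar L Δ f)

/-- `E(k) := 2ε_T(k)`. -/
def EK (k : Tor L) : ℝ := 2 * epsT L k

/-- `β(k) := c_s g(k) + d/2`. -/
def betaK (Δ lam2 : ℝ) (f : Tor L → ℝ) (k : Tor L) : ℝ := cS L Δ lam2 f * gres L lam2 k + dPar L Δ f / 2

/-- `z = e^{−ik·e}`. -/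
def zPh (k e : Tor L) : ℂ := (starRingEnd ℂ) (phase L k e)

/-- the closed part of `φ̂_e(k)`, `k ≠ 0`: `μ_e(k) = −(1 − z)β(k) + ½ q (1 + z)`, `z = e^{−ik·e}`. -/
def muK (Δ lam2 : ℝ) (f : Tor L → ℝ) (e k : Tor L) : ℂ :=
  -(1 - zPh L k e) * (betaK L Δ lam2 f k : ℂ) + ((qPar L Δ f / 2 : ℝ) : ℂ) * (1 + zPh L k e)

/-- `M(k) := Σ_e |μ_e(k)|² = 2β²E + ½q²(8 − E)` (`MKIdentity`). -/
def MK (Δ lam2 : ℝ) (f : Tor L → ℝ) (k : Tor L) : ℝ :=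
  2 * betaK L Δ lam2 f k ^ 2 * EK L k + qPar L Δ f ^ 2 * (8 - EK L k) / 2

/-- `R(k) := Σ_e Re(conj μ_e(k) μ_e(k′))`, `k′ = k + K₁`:
`ββ′(E + E′ − 2ε₁) − ½qβ(2ε₁ + E − E′) − ½qβ′(2ε₁ − E + E′) + ¼q²(16 − 2ε₁ − E − E′)` (`RKIdentity`). -/
def RK (Δ lam2 : ℝ) (f : Tor L → ℝ) (k : Tor L) : ℝ :=
  betaK L Δ lam2 f k * betaK L Δ lam2 f (k + K1 L) * (EK L k + EK L (k + K1 L) - 2 * eps1 L)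
    - qPar L Δ f / 2 * betaK L Δ lam2 f k * (2 * eps1 L + EK L k - EK L (k + K1 L))
    - qPar L Δ f / 2 * betaK L Δ lam2 f (k + K1 L) * (2 * eps1 L - EK L k + EK L (k + K1 L))
    + qPar L Δ f ^ 2 / 4 * (16 - 2 * eps1 L - EK L k - EK L (k + K1 L))

/-- the complex gradient tail `τ_e(k) := FT[(D_e s)²](k)` (its real part is `taufun`). -/
def tauC (Δ : ℝ) (f : Tor L → ℝ) (e k : Tor L) : ℂ := dft L (fun r => Dgrad L (sfun' L Δ f) e r ^ 2) k

/-! ## §2 Decomposition identities (closed + tail) and the closed-part sums over `e` -/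

/-- `F₂(0) = V + ‖h‖²` and `F₂(k) = c(k) + t(k)` for `k ≠ 0` (from `f = (1 − h)·1_{≠0}`, `ĥ = a + c_s g`, `dft_sfun'`). -/
def F2ClosedPlusTail (Δ : ℝ) : Prop :=
  ∀ lam2 : ℝ, ∀ f : Tor L → ℝ, IsGroundTwoMagnon L Δ lam2 f → 0 < lam2 →
    F2 L f 0 = nf2V L Δ f ∧ ∀ k : Tor L, k ≠ 0 → F2 L f k = cK L Δ lam2 f k + tfun L Δ f k

/-- `φ̂_e(0) = γ` and `φ̂_e(k) = μ_e(k) + ½(1 − e^{−ik·e}) t(k) + ½ τ_e(k)` for `k ≠ 0`, `e` a nearest neighbour. -/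
def PhiHatClosedPlusTail (Δ : ℝ) : Prop :=
  ∀ lam2 : ℝ, ∀ f : Tor L → ℝ, IsGroundTwoMagnon L Δ lam2 f → 0 < lam2 → ∀ e ∈ nnList L,
    phiHat L f e 0 = ((gamPar L Δ lam2 f : ℝ) : ℂ) ∧
    ∀ k : Tor L, k ≠ 0 →
      phiHat L f e k = muK L Δ lam2 f e k + (1 / 2 : ℂ) * (1 - zPh L k e) * ((tfun L Δ f k : ℝ) : ℂ)
                        + (1 / 2 : ℂ) * tauC L Δ f e k

/-- `Σ_{e ∈ nn} |μ_e(k)|² = M(k)` (uses `|1 − z|² = 2(1 − cos k·e)`, `Σ_e (1 − cos k·e) = E(k)`, and that the cross term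
`Re[(1 − z̄)(1 + z)] = 0`). -/
def MKIdentity (Δ : ℝ) : Prop :=
  ∀ lam2 : ℝ, ∀ f : Tor L → ℝ, ∀ k : Tor L,
    ((nnList L).map (fun e => Complex.normSq (muK L Δ lam2 f e k))).sum = MK L Δ lam2 f k

/-- `Σ_{e ∈ nn} Re(conj μ_e(k) · μ_e(k + K₁)) = R(k)` (uses `Σ_e cos(k·e) = 4 − E(k)`, `Σ_e cos(K₁·e) = 2 + 2cos θ = 4 − 2ε₁`). -/
def RKIdentity (Δ : ℝ) : Prop :=
  ∀ lam2 : ℝ, ∀ f : Tor L → ℝ, ∀ k : Tor L,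
    ((nnList L).map (fun e => ((starRingEnd ℂ) (muK L Δ lam2 f e k) * muK L Δ lam2 f e (k + K1 L)).re)).sum
      = RK L Δ lam2 f k

/-- `Σ_{e ∈ nn} ‖1 − e^{−ik·e}‖² = 2E(k)` (`= 4ε_T(k)`): the sine factors carried by the `t`-part of `φ̂_e − μ_e`. -/
def PhaseDefectSum : Prop :=
  ∀ k : Tor L, ((nnList L).map (fun e => Complex.normSq (1 - zPh L k e))).sum = 2 * EK L k

/-- complex form of T3(ii): `‖τ_e(k)‖ ≤ ‖D_e s‖²` (triangle inequality; the real part is `TauTailBound`, proved). -/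
def TauTailBoundC (Δ : ℝ) : Prop :=
  ∀ f : Tor L → ℝ, ∀ e k : Tor L, ‖tauC L Δ f e k‖ ≤ ∑ r : Tor L, Dgrad L (sfun' L Δ f) e r ^ 2

/-- COROLLARY used per momentum in the block and in the outer region: for `k ≠ 0` and `e ∈ nn`,
`‖φ̂_e(k) − μ_e(k)‖ ≤ ½‖1 − e^{−ik·e}‖·|t(k)| + ½ τ̄` (`PhiHatClosedPlusTail` + `TauTailBoundC` + `GradSNormClosed`). -/
def PhiHatNearClosed (Δ : ℝ) : Prop :=
  ∀ lam2 : ℝ, ∀ f : Tor L → ℝ, IsGroundTwoMagnon L Δ lam2 f → 0 < lam2 → ∀ e ∈ nnList L, ∀ k : Tor L, k ≠ 0 →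
    ‖phiHat L f e k - muK L Δ lam2 f e k‖
      ≤ ‖(1 : ℂ) - zPh L k e‖ / 2 * |tfun L Δ f k| + tauBar L Δ lam2 f / 2

/-- per-direction closed modulus: `|μ_e(k)|² = 2β²(1 − cos k·e) + (q²/2)(1 + cos k·e)` (the cross term
`Re[(1 − z̄)(1 + z)]` vanishes); used per momentum in the block. -/
def MuNormSq (Δ : ℝ) : Prop :=
  ∀ lam2 : ℝ, ∀ f : Tor L → ℝ, ∀ e k : Tor L,
    Complex.normSq (muK L Δ lam2 f e k)
      = 2 * betaK L Δ lam2 f k ^ 2 * (1 - (phase L k e).re) + qPar L Δ f ^ 2 / 2 * (1 + (phase L k e).re)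

/-- BLOCK, per `(e, k)`: with `P_e(k) := ‖1 − e^{−ik·e}‖/2·|t(k)| + τ̄/2` (`PhiHatNearClosed`) the evaluator encloses
`|φ̂_e(k)|² ∈ [max(|μ_e| − P_e, 0)², (|μ_e| + P_e)²]` and `Re(conj φ̂_e(k) φ̂_e(k′)) ∈ Re(conj μ_e(k) μ_e(k′)) ± (|μ_e(k)|P_e(k′) +
|μ_e(k′)|P_e(k) + P_e(k)P_e(k′))`; recorded as the elementary statement it rests on. -/
def BlockCrossTerm : Prop :=
  ∀ x y m n : ℂ, ∀ P Q : ℝ, ‖x - m‖ ≤ P → ‖y - n‖ ≤ Q →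
    |((starRingEnd ℂ) x * y).re - ((starRingEnd ℂ) m * n).re| ≤ ‖m‖ * Q + ‖n‖ * P + P * Q ∧
    |Complex.normSq x - Complex.normSq m| ≤ 2 * ‖m‖ * P + P ^ 2

/-! ## §3 The named one- and two-propagator sums (instances of `B1.torSum`) and their brackets -/

/-- `S₁ = Σ_k g(k)` (family A; on the solution manifold `c_s S₁ = V − a(V − 1)`, `GapEquationS1`). -/
def S1n (lam2 : ℝ) : ℝ := B1.torSum L lam2 ![((0 : ℤ), (0 : ℤ))] ![1]
/-- `S₂ = Σ g²`. -/
def S2n (lam2 : ℝ) : ℝ := B1.torSum L lam2 ![((0 : ℤ), (0 : ℤ))] ![2]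
/-- `S₃ = Σ g³`. -/
def S3n (lam2 : ℝ) : ℝ := B1.torSum L lam2 ![((0 : ℤ), (0 : ℤ))] ![3]
/-- `S₄ = Σ g⁴`. -/
def S4n (lam2 : ℝ) : ℝ := B1.torSum L lam2 ![((0 : ℤ), (0 : ℤ))] ![4]
/-- `T10 = Σ_k g(k) g(k + K₁)` (`= T(q)` for the four axis neighbours `q`). -/
def T10n (lam2 : ℝ) : ℝ := B1.torSum L lam2 ![((0 : ℤ), (0 : ℤ)), (1, 0)] ![1, 1]
/-- `T11 = Σ_k g(k) g(k + (1,1))` (`= T(q)` for the four diagonal neighbours `q`). -/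
def T11n (lam2 : ℝ) : ℝ := B1.torSum L lam2 ![((0 : ℤ), (0 : ℤ)), (1, 1)] ![1, 1]
/-- `G21 = Σ_k g(k)² g(k + K₁)`. -/
def G21n (lam2 : ℝ) : ℝ := B1.torSum L lam2 ![((0 : ℤ), (0 : ℤ)), (1, 0)] ![2, 1]
/-- `G12 = Σ_k g(k) g(k + K₁)²`. -/
def G12n (lam2 : ℝ) : ℝ := B1.torSum L lam2 ![((0 : ℤ), (0 : ℤ)), (1, 0)] ![1, 2]
/-- `G22 = Σ_k g(k)² g(k + K₁)²`. -/
def G22n (lam2 : ℝ) : ℝ := B1.torSum L lam2 ![((0 : ℤ), (0 : ℤ)), (1, 0)] ![2, 2]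
/-- `G31 = Σ_k g(k)³ g(k + K₁)`. -/
def G31n (lam2 : ℝ) : ℝ := B1.torSum L lam2 ![((0 : ℤ), (0 : ℤ)), (1, 0)] ![3, 1]
/-- `G13 = Σ_k g(k) g(k + K₁)³`. -/
def G13n (lam2 : ℝ) : ℝ := B1.torSum L lam2 ![((0 : ℤ), (0 : ℤ)), (1, 0)] ![1, 3]

/-- the cos-weighted convolution `Tx(q) := Σ_p g(p) g(q − p) cos(pₓ − q₁θ/2)` (`q ∈ ℤ²`; needed for `q = (1,0)` and
`q = (1,1)`: the gradient tails `τ_e` at the named momenta, `TauNamed`). -/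
def TxSum (lam2 : ℝ) (q : ℤ × ℤ) : ℝ :=
  ∑ p : Tor L, gres L lam2 p * gres L lam2 (B1.toTor L q - p)
    * Real.cos (2 * Real.pi * p.1.val / L - Real.pi * q.1 / L)

/-- the gap equation in named-sum form: `c_s S₁ = V − a(V − 1)` (`ŝ(0) = −a`, `s(0) = 1 − a`, `S₁ = V·G̃(0)`). -/
def GapEquationS1 (Δ : ℝ) : Prop :=
  ∀ lam2 : ℝ, ∀ f : Tor L → ℝ, IsGroundTwoMagnon L Δ lam2 f → 0 < lam2 →
    cS L Δ lam2 f * S1n L lam2 = (L : ℝ) ^ 2 - aPar L Δ f * ((L : ℝ) ^ 2 - 1)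

/-- `‖s‖² = (c_s² S₂ + a²)/V` (Parseval). -/
def SNormNamed (Δ : ℝ) : Prop :=
  ∀ lam2 : ℝ, ∀ f : Tor L → ℝ, IsGroundTwoMagnon L Δ lam2 f → 0 < lam2 →
    sNormSq L Δ f = (cS L Δ lam2 f ^ 2 * S2n L lam2 + dPar L Δ f) / (L : ℝ) ^ 2

/-- `G̃(0) = S₁/V` (`Gzero` of KT1Targets vs the named sum). -/
def GzeroNamed : Prop := ∀ lam2 : ℝ, Gzero L lam2 = S1n L lam2 / (L : ℝ) ^ 2

/-- `t(q)` at the named momenta: `t(q) = (c_s² T(q) − 2a c_s g(q))/V` with `T(q) = T10` (`q` an axis neighbour) resp. `T11`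
(`q` a diagonal neighbour). -/
def TfunNamed (Δ : ℝ) : Prop :=
  ∀ lam2 : ℝ, ∀ f : Tor L → ℝ, IsGroundTwoMagnon L Δ lam2 f → 0 < lam2 →
    (∀ q ∈ [ex L, -ex L, ey L, -ey L],
      tfun L Δ f q = (cS L Δ lam2 f ^ 2 * T10n L lam2 - 2 * aPar L Δ f * cS L Δ lam2 f * gres L lam2 q) / (L : ℝ) ^ 2) ∧
    (∀ q ∈ [ex L + ey L, ex L - ey L, -ex L + ey L, -ex L - ey L],
      tfun L Δ f q = (cS L Δ lam2 f ^ 2 * T11n L lam2 - 2 * aPar L Δ f * cS L Δ lam2 f * gres L lam2 q) / (L : ℝ) ^ 2)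

/-- `τ_e(q)` at the named momenta (`V τ_e(q)/c_s² = Θ_e(q) = T(q)(1 + e^{−iq·e}) − 2e^{−iq·e/2}·X`, with `X = Tx(1,0)` for `q`
an axis neighbour parallel to `e`, `X = Tx(1,1)` for `q` diagonal, and for `q` an axis neighbour orthogonal to `e` the reducible
`X = Ty := (2 − λ₂/2)T10 − ½(S₁ − g(K₁)) − cos(θ/2)·Tx(1,0)`); recorded for the representative pairs, the others follow by the
lattice symmetries of `g`. -/
def TauNamed (Δ : ℝ) : Prop :=
  ∀ lam2 : ℝ, ∀ f : Tor L → ℝ, IsGroundTwoMagnon L Δ lam2 f → 0 < lam2 →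
    let c2V : ℂ := ((cS L Δ lam2 f ^ 2 / (L : ℝ) ^ 2 : ℝ) : ℂ)
    let w : ℂ := Complex.exp (-(Real.pi / L : ℝ) * Complex.I)          -- e^{−iθ/2}
    -- q = K₁, e = x̂ :
    tauC L Δ f (ex L) (K1 L)
        = c2V * (((T10n L lam2 : ℝ) : ℂ) * (1 + w ^ 2) - 2 * w * ((TxSum L lam2 (1, 0) : ℝ) : ℂ)) ∧
    -- q = K₁, e = ŷ :
    tauC L Δ f (ey L) (K1 L)
        = c2V * (2 * ((T10n L lam2 : ℝ) : ℂ)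
            - 2 * (((2 - lam2 / 2) * T10n L lam2 - (S1n L lam2 - gres L lam2 (K1 L)) / 2
                      - Real.cos (Real.pi / L) * TxSum L lam2 (1, 0) : ℝ) : ℂ)) ∧
    -- q = (1,1), e = x̂ :
    tauC L Δ f (ex L) (ex L + ey L)
        = c2V * (((T11n L lam2 : ℝ) : ℂ) * (1 + w ^ 2) - 2 * w * ((TxSum L lam2 (1, 1) : ℝ) : ℂ))

/-- the B1 BRACKET INSTANCES at `θ₀ = 2π/128`, `K = 32` (each is `B1.b1Bracket` specialised; listed so that the cell evaluator
and the provers agree on `(s, a, S, n)`): for `L ≥ 128`, `0 ≤ ν < 4/π²`, with `θ = 2π/L`, `λ₂ = νθ²`,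
`loSum ν 32 S s a ≤ θ^{2n}·torSum ≤ hiSum ν θ₀ 32 S s a + tailConst ν (32 − 2S) n` for the eleven named sums. -/
def NamedSumBrackets : Prop :=
  ∀ (L : ℕ) [NeZero L], 128 ≤ L → ∀ ν : ℝ, 0 ≤ ν → ν < 4 / Real.pi ^ 2 →
    let θ : ℝ := 2 * Real.pi / L
    let θ0 : ℝ := 2 * Real.pi / 128
    let br : (n S : ℕ) → {m : ℕ} → (Fin m → ℤ × ℤ) → (Fin m → ℕ) → Prop := fun n S _ s a =>
      B1.loSum ν 32 S s a ≤ θ ^ (2 * n) * B1.torSum L (ν * θ ^ 2) s a ∧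
        θ ^ (2 * n) * B1.torSum L (ν * θ ^ 2) s a ≤ B1.hiSum ν θ0 32 S s a + B1.tailConst ν (32 - 2 * S) n
    br 2 0 ![((0 : ℤ), (0 : ℤ))] ![2] ∧ br 3 0 ![((0 : ℤ), (0 : ℤ))] ![3] ∧ br 4 0 ![((0 : ℤ), (0 : ℤ))] ![4] ∧
    br 2 1 ![((0 : ℤ), (0 : ℤ)), (1, 0)] ![1, 1] ∧ br 2 1 ![((0 : ℤ), (0 : ℤ)), (1, 1)] ![1, 1] ∧
    br 3 1 ![((0 : ℤ), (0 : ℤ)), (1, 0)] ![2, 1] ∧ br 3 1 ![((0 : ℤ), (0 : ℤ)), (1, 0)] ![1, 2] ∧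
    br 4 1 ![((0 : ℤ), (0 : ℤ)), (1, 0)] ![2, 2] ∧ br 4 1 ![((0 : ℤ), (0 : ℤ)), (1, 0)] ![3, 1] ∧
    br 4 1 ![((0 : ℤ), (0 : ℤ)), (1, 0)] ![1, 3]

/-- lower window sum for the cos-weighted convolution: on the window both `p` and `p − q` satisfy `|·|∞ ≤ K`, so
`|j| = |p₁ − q₁/2| ≤ K − ½` (`q₁ = 1`) and `cos(θ j) ≥ cos(θ₀|j|) ≥ 0` for `θ ≤ θ₀` as long as `θ₀(K − ½) ≤ π/2`
(`K = 32`, `θ₀ = 2π/128`: `θ₀·31.5 = 1.546`). -/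
def loSumTx (ν θ0 : ℝ) (K : ℕ) (q : ℤ × ℤ) : ℝ :=
  ∑ p ∈ B1.idx K 1 ![((0 : ℤ), (0 : ℤ)), -q],
    (1 / (B1.nsq p - ν)) * (1 / (B1.nsq (p - q) - ν)) * Real.cos (θ0 * |(p.1 : ℝ) - (q.1 : ℝ) / 2|)

/-- ★ BRACKET for `Tx(1,0)`, `Tx(1,1)` (`θ₀ = 2π/128`, `K = 32`, `K′ = 30`): for `L ≥ 128`, `0 ≤ ν < 4/π²`,
`loSumTx − tailConst ≤ θ⁴·Tx(q) ≤ hiSum + tailConst` (the window weight lies in `[cos(θ₀|j|), 1]`, the tail weight in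
`[−1, 1]`; same window/tail split as `B1.b1Bracket`). -/
def TxBracket : Prop :=
  ∀ (L : ℕ) [NeZero L], 128 ≤ L → ∀ ν : ℝ, 0 ≤ ν → ν < 4 / Real.pi ^ 2 →
    ∀ q ∈ [((1 : ℤ), (0 : ℤ)), (1, 1)],
      let θ : ℝ := 2 * Real.pi / L
      let θ0 : ℝ := 2 * Real.pi / 128
      loSumTx ν θ0 32 q - B1.tailConst ν 30 2 ≤ θ ^ 4 * TxSum L (ν * θ ^ 2) q ∧
        θ ^ 4 * TxSum L (ν * θ ^ 2) q
          ≤ B1.hiSum ν θ0 32 1 ![((0 : ℤ), (0 : ℤ)), -q] ![1, 1] + B1.tailConst ν 30 2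

/-! ## §4 Reductions of weighted one-propagator sums (the closed expansions and the outer majorants are polynomials in
`g, g′, E, E′`; `E g = 1 + λ₂ g` off `0`, `cos kₓ`-weights reduce by the x↔y symmetry of `g`) -/

/-- `E(k) g(k) = 1 + λ₂ g(k)` (`k ≠ 0`), `E(0) g(0) = 0`. -/
def EnergyTimesPropagator : Prop :=
  ∀ lam2 : ℝ, ∀ k : Tor L, k ≠ 0 → 2 * epsT L k - lam2 ≠ 0 → EK L k * gres L lam2 k = 1 + lam2 * gres L lam2 k

/-- `Σ_k g^j cos kₓ = (1 − λ₂/4) S_j − S_{j−1}/4` (`j ≥ 2`) and `Σ_k g cos kₓ = (1 − λ₂/4) S₁ − (V − 1)/4`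
(`2(1 − cos kₓ) + 2(1 − cos k_y) = E`, `Σ g^j cos kₓ = Σ g^j cos k_y`). -/
def CosWeightedReduction : Prop :=
  ∀ lam2 : ℝ, (∀ k : Tor L, k ≠ 0 → 2 * epsT L k - lam2 ≠ 0) →
    (∑ k : Tor L, gres L lam2 k * Real.cos (2 * Real.pi * k.1.val / L))
        = (1 - lam2 / 4) * S1n L lam2 - ((L : ℝ) ^ 2 - 1) / 4 ∧
    (∑ k : Tor L, gres L lam2 k ^ 2 * Real.cos (2 * Real.pi * k.1.val / L))
        = (1 - lam2 / 4) * S2n L lam2 - S1n L lam2 / 4 ∧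
    (∑ k : Tor L, gres L lam2 k ^ 3 * Real.cos (2 * Real.pi * k.1.val / L))
        = (1 - lam2 / 4) * S3n L lam2 - S2n L lam2 / 4 ∧
    (∑ k : Tor L, gres L lam2 k ^ 4 * Real.cos (2 * Real.pi * k.1.val / L))
        = (1 - lam2 / 4) * S4n L lam2 - S3n L lam2 / 4

open Classical in
/-- `T′ = (ℤ/L)² ∖ {0, −K₁}` as a `Finset`. -/
def torPrime : Finset (Tor L) := Finset.univ.filter (fun k : Tor L => k ≠ 0 ∧ k + K1 L ≠ 0)

/-- `Σ_{k ∈ T′} g(k′)^j E(k)` in named form (`k′ = k + K₁`; shift `k ↦ k − K₁`, `E(k − K₁) = 4 − 2cos θ cos kₓ − 2 sin θ sin kₓ −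
2cos k_y`, the sine sum vanishes, then `CosWeightedReduction`): with `C_j := Σ g^j cos kₓ`, `g₁ := g(K₁)`,
`= 4(S_j − g₁^j) − 2cos θ (C_j − g₁^j cos θ) + 2 sin²θ · g₁^j − 2(C_j − g₁^j)`, `j = 1, 2`. -/
def ShiftedEnergyReduction : Prop :=
  ∀ lam2 : ℝ, (∀ k : Tor L, k ≠ 0 → 2 * epsT L k - lam2 ≠ 0) →
    let θ : ℝ := 2 * Real.pi / L
    let g1 : ℝ := gres L lam2 (K1 L)
    let C1 : ℝ := ∑ k : Tor L, gres L lam2 k * Real.cos (2 * Real.pi * k.1.val / L)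
    let C2 : ℝ := ∑ k : Tor L, gres L lam2 k ^ 2 * Real.cos (2 * Real.pi * k.1.val / L)
    (∑ k ∈ torPrime L, gres L lam2 (k + K1 L) * EK L k)
        = 4 * (S1n L lam2 - g1) - 2 * Real.cos θ * (C1 - g1 * Real.cos θ) + 2 * Real.sin θ ^ 2 * g1 - 2 * (C1 - g1) ∧
    (∑ k ∈ torPrime L, gres L lam2 (k + K1 L) ^ 2 * EK L k)
        = 4 * (S2n L lam2 - g1 ^ 2) - 2 * Real.cos θ * (C2 - g1 ^ 2 * Real.cos θ) + 2 * Real.sin θ ^ 2 * g1 ^ 2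
          - 2 * (C2 - g1 ^ 2)

/-! ## §5 Closed-part expansions into named sums (exact identities; `c = cS`, `d = dPar`, `q = qPar`, `g₁ = g(K₁)`,
`S₁` via `GapEquationS1`) -/

/-- `B`: `Σ_{k ∈ T′} c(k)² c(k′) = −[8c³G21 + 4c²d(S₂ − g₁²) + 8c²d T10 + 6cd²(S₁ − g₁) + d³(V − 2)]`. -/
def BClosedExpansion (Δ : ℝ) : Prop :=
  ∀ lam2 : ℝ, ∀ f : Tor L → ℝ, 0 < lam2 → lam2 < eps1 L →
    let c := cS L Δ lam2 f
    let d := dPar L Δ f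
    let g1 := gres L lam2 (K1 L)
    (∑ k ∈ torPrime L, cK L Δ lam2 f k ^ 2 * cK L Δ lam2 f (k + K1 L))
      = -(8 * c ^ 3 * G21n L lam2 + 4 * c ^ 2 * d * (S2n L lam2 - g1 ^ 2) + 8 * c ^ 2 * d * T10n L lam2
          + 6 * c * d ^ 2 * (S1n L lam2 - g1) + d ^ 3 * ((L : ℝ) ^ 2 - 2))

open Classical in
/-- `‖Π⁰‖²`: `Σ_{k ≠ 0} c(k)³ = −[8c³S₃ + 12c²dS₂ + 6cd²S₁ + d³(V − 1)]`. -/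
def Pi2ClosedExpansion (Δ : ℝ) : Prop :=
  ∀ lam2 : ℝ, ∀ f : Tor L → ℝ,
    let c := cS L Δ lam2 f
    let d := dPar L Δ f
    (∑ k ∈ (Finset.univ : Finset (Tor L)).erase 0, cK L Δ lam2 f k ^ 3)
      = -(8 * c ^ 3 * S3n L lam2 + 12 * c ^ 2 * d * S2n L lam2 + 6 * c * d ^ 2 * S1n L lam2 + d ^ 3 * ((L : ℝ) ^ 2 - 1))

open Classical in
/-- `A(x̂)`: `Σ_{k ≠ 0} c(k)² cos kₓ = 4c²[(1 − λ₂/4)S₂ − S₁/4] + 4cd[(1 − λ₂/4)S₁ − (V − 1)/4] − d²`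
(`CosWeightedReduction`, `Σ_{k ≠ 0} cos kₓ = −1`). -/
def AxClosedExpansion (Δ : ℝ) : Prop :=
  ∀ lam2 : ℝ, ∀ f : Tor L → ℝ, 0 < lam2 → lam2 < eps1 L →
    let c := cS L Δ lam2 f
    let d := dPar L Δ f
    (∑ k ∈ (Finset.univ : Finset (Tor L)).erase 0, cK L Δ lam2 f k ^ 2 * Real.cos (2 * Real.pi * k.1.val / L))
      = 4 * c ^ 2 * ((1 - lam2 / 4) * S2n L lam2 - S1n L lam2 / 4)
        + 4 * c * d * ((1 - lam2 / 4) * S1n L lam2 - ((L : ℝ) ^ 2 - 1) / 4) - d ^ 2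

open Classical in
/-- `⟨Π⁰,C0⟩`: `Σ_{k ≠ 0} M(k) c(k) = −(2c·M_g + d·M₀)` with (`Σ_{k≠0} E g^i = S_{i−1} + λ₂S_i`, `S₀ = V − 1`, `Σ_{k≠0} E = 4V`)
`M₀ := Σ_{k≠0} M = 2[c²(S₁ + λ₂S₂) + cd(V − 1 + λ₂S₁) + d²V] + 4q²(V − 1) − 2q²V`,
`M_g := Σ_{k≠0} M g = 2[c²(S₂ + λ₂S₃) + cd(S₁ + λ₂S₂) + (d²/4)(V − 1 + λ₂S₁)] + 4q²S₁ − (q²/2)(V − 1 + λ₂S₁)`. -/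
def PC0ClosedExpansion (Δ : ℝ) : Prop :=
  ∀ lam2 : ℝ, ∀ f : Tor L → ℝ, 0 < lam2 → lam2 < eps1 L →
    let c := cS L Δ lam2 f
    let d := dPar L Δ f
    let q := qPar L Δ f
    let V : ℝ := (L : ℝ) ^ 2
    let S1 := S1n L lam2
    let S2 := S2n L lam2
    let S3 := S3n L lam2
    let M0 : ℝ := 2 * (c ^ 2 * (S1 + lam2 * S2) + c * d * (V - 1 + lam2 * S1) + d ^ 2 * V) + 4 * q ^ 2 * (V - 1) - 2 * q ^ 2 * V
    let Mg : ℝ := 2 * (c ^ 2 * (S2 + lam2 * S3) + c * d * (S1 + lam2 * S2) + d ^ 2 / 4 * (V - 1 + lam2 * S1))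
                    + 4 * q ^ 2 * S1 - q ^ 2 / 2 * (V - 1 + lam2 * S1)
    (∑ k ∈ (Finset.univ : Finset (Tor L)).erase 0, MK L Δ lam2 f k * cK L Δ lam2 f k) = -(2 * c * Mg + d * M0)

/-- `B_C`: the closed part `Σ_{k ∈ T′} [R(k)(c(k) + c(k′)) + M(k) c(k′)]` is a polynomial in `g, g′, E, E′` (degree ≤ 3 in the
propagators, linear in `E` or `E′`, never both); its value in named sums follows mechanically from `EnergyTimesPropagator`,
`CosWeightedReduction`, `ShiftedEnergyReduction` and the two-propagator table `Σ_{T′} g^i g′^j ∈ {T10, G21, G12, G22, G31,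
G13}`, `Σ_{T′} g^i g′^j E = Σ g^{i−1}g′^j + λ₂ Σ g^i g′^j` (`i, j ≥ 1`), and `k ↦ −k − K₁` (swaps `(g,E) ↔ (g′,E′)`).  Recorded as
the definitional abbreviation used by `BCOuterBound`; cycle22/calc/level2_N1.py `Reducer` checks the reduction against the direct
sum to 1e−7 relative (L = 32 … 128). -/
def bcClosedSum (Δ lam2 : ℝ) (f : Tor L → ℝ) (A : Finset (Tor L)) : ℝ :=
  ∑ k ∈ A, (RK L Δ lam2 f k * (cK L Δ lam2 f k + cK L Δ lam2 f (k + K1 L)) + MK L Δ lam2 f k * cK L Δ lam2 f (k + K1 L))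

/-! ## §6 Regions, the tail slope `κ̂`, and the OUTER-TAIL MAJORANTS (one `Prop` per object) -/

/-- the pair block `{−M₂−1 ≤ p₁ ≤ M₂, |p₂| ≤ M₂} ∖ {(0,0), (−1,0)}` read on the torus (both `k` and `k′ = k + K₁` then lie in
`|·|∞ ≤ M₂ + 1`). -/
def blockP (M2 : ℕ) : Finset (Tor L) :=
  (((Finset.Icc (-(M2 : ℤ) - 1) M2 ×ˢ Finset.Icc (-(M2 : ℤ)) M2).erase (0, 0)).erase (-1, 0)).image (B1.toTor L)

/-- the punctured single block `{|p|∞ ≤ M₂} ∖ {0}` on the torus. -/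
def block1 (M2 : ℕ) : Finset (Tor L) := ((B1.box M2).erase (0, 0)).image (B1.toTor L)

open Classical in
/-- the outer pair region `T′ ∖ blockP`. -/
def outerP (M2 : ℕ) : Finset (Tor L) := (torPrime L).filter (fun k => k ∉ blockP L M2)

open Classical in
/-- the outer single region `(ℤ/L)² ∖ ({0} ∪ block1)`. -/
def outer1 (M2 : ℕ) : Finset (Tor L) := ((Finset.univ : Finset (Tor L)).erase 0).filter (fun k => k ∉ block1 L M2)

/-- REGION SPLIT (pair objects `B`, `B_C`): `(ℤ/L)² = {0} ⊔ {−K₁} ⊔ blockP ⊔ outerP` once `2M₂ + 3 ≤ L`. -/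
def PairRegionSplit (M2 : ℕ) : Prop :=
  2 * M2 + 3 ≤ L → ∀ φ : Tor L → ℝ,
    ∑ k : Tor L, φ k = φ 0 + φ (-K1 L) + ∑ k ∈ blockP L M2, φ k + ∑ k ∈ outerP L M2, φ k

/-- REGION SPLIT (single objects `‖Π⁰‖²`, `A(x̂)`, `⟨Π⁰,C0⟩`): `(ℤ/L)² = {0} ⊔ block1 ⊔ outer1` once `2M₂ + 1 ≤ L`. -/
def SingleRegionSplit (M2 : ℕ) : Prop :=
  2 * M2 + 1 ≤ L → ∀ φ : Tor L → ℝ,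
    ∑ k : Tor L, φ k = φ 0 + ∑ k ∈ block1 L M2, φ k + ∑ k ∈ outer1 L M2, φ k

/-- off the pair block both `k` and `k′` are far: `k ∈ outerP ⇒ ε_T(k) ≥ ε_m ∧ ε_T(k + K₁) ≥ ε_m`, `ε_m = 1 − cos((M₂+1)θ)`;
off the single block `ε_T(k) ≥ ε_m`. -/
def OuterEnergyFloor (M2 : ℕ) : Prop :=
  4 * (M2 + 2) ≤ L →
    let em : ℝ := 1 - Real.cos (2 * Real.pi * (M2 + 1) / L)
    (∀ k ∈ outerP L M2, em ≤ epsT L k ∧ em ≤ epsT L (k + K1 L)) ∧ (∀ k ∈ outer1 L M2, em ≤ epsT L k)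

/-- `ρ_{M₂} := (2ε_m − λ₂)/(2ε_m − 4λ₂)`, `ε_m := 1 − cos((M₂+1)θ)` = the least `ε_T` off the block. -/
def rhoM (lam2 : ℝ) (M2 : ℕ) : ℝ :=
  let em : ℝ := 1 - Real.cos (2 * Real.pi * (M2 + 1) / L)
  (2 * em - lam2) / (2 * em - 4 * lam2)

/-- the tail slope `κ̂ := 4 c_s² G̃(0) ρ_{M₂}`: off the block `|t(q)| ≤ κ̂ g(q)` (from `TtailBounds` (i),(iii):
`1/(ε_T − 2λ₂) ≤ 2ρ g`, and `2a c_s/V ≤ κ̂`). -/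
def kapHat (Δ lam2 : ℝ) (f : Tor L → ℝ) (M2 : ℕ) : ℝ := 4 * cS L Δ lam2 f ^ 2 * Gzero L lam2 * rhoM L lam2 M2

/-- ★ TAIL SLOPE off the block: in the regime, `|t(k)| ≤ κ̂ g(k)` for every `k` with `ε_T(k) ≥ ε_m` (`TtailBounds` (i),(iii),
`1/(ε_T − 2λ₂) ≤ 2ρ_{M₂} g` there, and `2a c_s/V ≤ 4c_s²G̃(0)`). -/
def TailSlopeBound (Δ : ℝ) (M2 : ℕ) : Prop :=
  ∀ lam2 : ℝ, ∀ f : Tor L → ℝ, IsGroundTwoMagnon L Δ lam2 f → 0 < lam2 → lam2 ≤ 0.0513 * (2 * Real.pi / L) ^ 2 →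
    4 * (M2 + 2) ≤ L → ∀ k : Tor L, k ≠ 0 → 1 - Real.cos (2 * Real.pi * (M2 + 1) / L) ≤ epsT L k →
      |tfun L Δ f k| ≤ kapHat L Δ lam2 f M2 * gres L lam2 k

/-- the KT regime of piece A at `L ≥ 128` used by all outer bounds: ground state, `0 < λ₂ ≤ .0513 θ²`, block inside the
quarter zone. -/
def L2Regime (Δ lam2 : ℝ) (f : Tor L → ℝ) (M2 : ℕ) : Prop :=
  IsGroundTwoMagnon L Δ lam2 f ∧ 0 < lam2 ∧ lam2 ≤ 0.0513 * (2 * Real.pi / L) ^ 2 ∧ 128 ≤ L ∧ 4 * (M2 + 2) ≤ L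

/-- ★ `B` OUTER BOUND: `|Σ_{outer} (F₂²F₂′ − c²c′)| ≤ Σ_{outer} [κ̂(2|c||c′|g + c²g′) + κ̂²(g²|c′| + 2|c|gg′) + κ̂³g²g′]`
(`|c| = 2c_s g + d`; from `F₂ = c + t`, `|t| ≤ κ̂g`, `|t′| ≤ κ̂g′`). -/
def BOuterBound (Δ : ℝ) (M2 : ℕ) : Prop :=
  ∀ lam2 : ℝ, ∀ f : Tor L → ℝ, L2Regime L Δ lam2 f M2 →
    let g := gres L lam2
    let ac : Tor L → ℝ := fun k => 2 * cS L Δ lam2 f * g k + dPar L Δ f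
    let κ := kapHat L Δ lam2 f M2
    |∑ k ∈ outerP L M2, (F2 L f k ^ 2 * F2 L f (k + K1 L) - cK L Δ lam2 f k ^ 2 * cK L Δ lam2 f (k + K1 L))|
      ≤ ∑ k ∈ outerP L M2,
          (κ * (2 * ac k * ac (k + K1 L) * g k + ac k ^ 2 * g (k + K1 L))
            + κ ^ 2 * (g k ^ 2 * ac (k + K1 L) + 2 * ac k * g k * g (k + K1 L)) + κ ^ 3 * g k ^ 2 * g (k + K1 L))

/-- ★ `‖Π⁰‖²` OUTER BOUND: `|Σ_{outer1} (F₂³ − c³)| ≤ Σ [3κ̂c²g + 3κ̂²|c|g² + κ̂³g³]`. -/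
def Pi2OuterBound (Δ : ℝ) (M2 : ℕ) : Prop :=
  ∀ lam2 : ℝ, ∀ f : Tor L → ℝ, L2Regime L Δ lam2 f M2 →
    let g := gres L lam2
    let ac : Tor L → ℝ := fun k => 2 * cS L Δ lam2 f * g k + dPar L Δ f
    let κ := kapHat L Δ lam2 f M2
    |∑ k ∈ outer1 L M2, (F2 L f k ^ 3 - cK L Δ lam2 f k ^ 3)|
      ≤ ∑ k ∈ outer1 L M2, (3 * κ * ac k ^ 2 * g k + 3 * κ ^ 2 * ac k * g k ^ 2 + κ ^ 3 * g k ^ 3)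

/-- ★ `A(x̂)` OUTER BOUND: `|Σ_{outer1} (F₂² − c²) cos kₓ| ≤ Σ [2κ̂|c|g + κ̂²g²]`. -/
def AxOuterBound (Δ : ℝ) (M2 : ℕ) : Prop :=
  ∀ lam2 : ℝ, ∀ f : Tor L → ℝ, L2Regime L Δ lam2 f M2 →
    let g := gres L lam2
    let ac : Tor L → ℝ := fun k => 2 * cS L Δ lam2 f * g k + dPar L Δ f
    let κ := kapHat L Δ lam2 f M2
    |∑ k ∈ outer1 L M2, (F2 L f k ^ 2 - cK L Δ lam2 f k ^ 2) * Real.cos (2 * Real.pi * k.1.val / L)|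
      ≤ ∑ k ∈ outer1 L M2, (2 * κ * ac k * g k + κ ^ 2 * g k ^ 2)

/-- ★ `⟨Π⁰,C0⟩` OUTER BOUND (`m₀ > 0` free): with `β = c_s g + d/2`, `Y := 2βκ̂gE + τ̄(β²E/m₀ + 2m₀) + 8qκ̂g + 4qτ̄`
(`≥ 2Σ_e|μ_e||φ̂_e − μ_e|`, by `|μ_e| ≤ ‖1−z‖β + q`, `Σ_e ‖1−z‖² = 2E`, Young) and `P₂ := Eκ̂²g² + 2τ̄²` (`≥ Σ_e|φ̂_e − μ_e|²`):
`|Σ_{outer1} Σ_e (|φ̂_e|²F₂ − |μ_e|²c)| ≤ Σ_{outer1} [M κ̂ g + (Y + P₂)(|c| + κ̂g)]`. -/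
def PC0OuterBound (Δ : ℝ) (M2 : ℕ) (m0 : ℝ) : Prop :=
  ∀ lam2 : ℝ, ∀ f : Tor L → ℝ, L2Regime L Δ lam2 f M2 → 0 < m0 →
    let g := gres L lam2
    let ac : Tor L → ℝ := fun k => 2 * cS L Δ lam2 f * g k + dPar L Δ f
    let κ := kapHat L Δ lam2 f M2
    let τ := tauBar L Δ lam2 f
    let q := qPar L Δ f
    let β := betaK L Δ lam2 f
    let Y : Tor L → ℝ := fun k =>
      2 * β k * κ * g k * EK L k + τ * (β k ^ 2 * EK L k / m0 + 2 * m0) + 8 * q * κ * g k + 4 * q * τ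
    let P2 : Tor L → ℝ := fun k => EK L k * κ ^ 2 * g k ^ 2 + 2 * τ ^ 2
    |∑ k ∈ outer1 L M2,
        (((nnList L).map (fun e => Complex.normSq (phiHat L f e k))).sum * F2 L f k - MK L Δ lam2 f k * cK L Δ lam2 f k)|
      ≤ ∑ k ∈ outer1 L M2, (MK L Δ lam2 f k * κ * g k + (Y k + P2 k) * (ac k + κ * g k))

/-- the `B_C` summand at `(e, k)`: `Re[conj φ̂_e(k) φ̂_e(k′)]·(F₂(k) + F₂(k′)) + |φ̂_e(k)|² F₂(k′)` (as in `BCOneLoop`). -/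
def bcSummand (f : Tor L → ℝ) (e k : Tor L) : ℝ :=
  ((starRingEnd ℂ) (phiHat L f e k) * phiHat L f e (k + K1 L)).re * (F2 L f k + F2 L f (k + K1 L))
    + Complex.normSq (phiHat L f e k) * F2 L f (k + K1 L)

/-- ★ `B_C` OUTER BOUND (`m₀ > 0` free): with `Rabs := ββ′(E + E′ + 2ε₁) + (q/2)(β + β′)(2ε₁ + E + E′) + 4q²` (`≥ |R|`),
`Z := |c| + |c′| + κ̂(g + g′)`, `Z′ := |c′| + κ̂g′`,
`D₁ := (κ̂/2)βg′(E+E′) + τ̄(β²E/(2m₀) + m₀) + (κ̂/2)β′g(E+E′) + τ̄(β′²E′/(2m₀) + m₀) + 4qτ̄ + τ̄² + (4qκ̂ + 2τ̄κ̂)(g + g′)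
 + (κ̂²/4)gg′(E+E′)` (`≥ Σ_e (|μ_e||ρ′_e| + |μ′_e||ρ_e| + |ρ_e||ρ′_e|)`, `ρ = φ̂ − μ`), and `Y, P₂` as in `PC0OuterBound`:
`|Σ_{outerP} Σ_e (bcSummand − [R(c + c′) + M c′])| ≤ Σ_{outerP} [Rabs·κ̂(g + g′) + D₁·Z + M κ̂ g′ + (Y + P₂)·Z′]`. -/
def BCOuterBound (Δ : ℝ) (M2 : ℕ) (m0 : ℝ) : Prop :=
  ∀ lam2 : ℝ, ∀ f : Tor L → ℝ, L2Regime L Δ lam2 f M2 → 0 < m0 →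
    let g := gres L lam2
    let ac : Tor L → ℝ := fun k => 2 * cS L Δ lam2 f * g k + dPar L Δ f
    let κ := kapHat L Δ lam2 f M2
    let τ := tauBar L Δ lam2 f
    let q := qPar L Δ f
    let β := betaK L Δ lam2 f
    let E := EK L
    let k1 := K1 L
    let Y : Tor L → ℝ := fun k =>
      2 * β k * κ * g k * E k + τ * (β k ^ 2 * E k / m0 + 2 * m0) + 8 * q * κ * g k + 4 * q * τ
    let P2 : Tor L → ℝ := fun k => E k * κ ^ 2 * g k ^ 2 + 2 * τ ^ 2
    let Rabs : Tor L → ℝ := fun k =>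
      β k * β (k + k1) * (E k + E (k + k1) + 2 * eps1 L)
        + q / 2 * (β k + β (k + k1)) * (2 * eps1 L + E k + E (k + k1)) + 4 * q ^ 2
    let Z : Tor L → ℝ := fun k => ac k + ac (k + k1) + κ * (g k + g (k + k1))
    let Z' : Tor L → ℝ := fun k => ac (k + k1) + κ * g (k + k1)
    let D1 : Tor L → ℝ := fun k =>
      κ / 2 * β k * g (k + k1) * (E k + E (k + k1)) + τ * (β k ^ 2 * E k / (2 * m0) + m0)
        + κ / 2 * β (k + k1) * g k * (E k + E (k + k1)) + τ * (β (k + k1) ^ 2 * E (k + k1) / (2 * m0) + m0)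
        + 4 * q * τ + τ ^ 2 + (4 * q * κ + 2 * τ * κ) * (g k + g (k + k1))
        + κ ^ 2 / 4 * g k * g (k + k1) * (E k + E (k + k1))
    |∑ k ∈ outerP L M2, (((nnList L).map (fun e => bcSummand L f e k)).sum
        - (RK L Δ lam2 f k * (cK L Δ lam2 f k + cK L Δ lam2 f (k + k1)) + MK L Δ lam2 f k * cK L Δ lam2 f (k + k1)))|
      ≤ ∑ k ∈ outerP L M2,
          (Rabs k * κ * (g k + g (k + k1)) + D1 k * Z k + MK L Δ lam2 f k * κ * g (k + k1) + (Y k + P2 k) * Z' k)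

/-! ## §7 Assembly: `T⁺` from the `⟨Π⁰,C0⟩`, `‖Π⁰‖²` brackets; the rest is LANDED
(`KT1Assembly.trialGapN1_ge_of_brackets` / `trialGap_pointwise_of_brackets` / `trialGapAbs_of_brackets`, p758258: brackets
`Bterm ≤ B⁺ ≤ 0`, `PiNormSq ≤ P⁺`, `Axhat ≤ A⁺`, `BCterm ≥ B_C⁻`, `T⁻ ≤ Tplus ≤ T⁺⁺` ⇒ `c·Uunit ≤ trialGapN1`). The five object
brackets are produced by: region split (§6) + special momenta (`F2ClosedPlusTail`, `PhiHatClosedPlusTail` at `0`, `±K₁`) + named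
momenta (`TfunNamed`, `TauNamed`, §3 brackets) + block per momentum (`TtailBounds`, `PhiHatNearClosed`, `MuNormSq`,
`BlockCrossTerm`) + outer (`…ClosedExpansion` + `…OuterBound`), and the scalars by `GapEquationS1`, `SNormNamed`, `GzeroNamed`. -/

/-- ★ `T⁺` FROM THE BRACKETS ON `Q := ⟨Π⁰,C0⟩ = Σ_c Π⁰C0` and `P := ‖Π⁰‖²`: `T⁺ = 3λ₂ + Q/P` (`sum_piR_C0fn`, proved), so
`Q ∈ [Q⁻,Q⁺]`, `P ∈ [P⁻,P⁺]`, `P⁻ > 0` give `3λ₂ + min(Q⁻/P⁻, Q⁻/P⁺) ≤ T⁺ ≤ 3λ₂ + max(Q⁺/P⁻, Q⁺/P⁺)` — the `Tlo/Thi` of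
`KT1Assembly` and of `KT2Assembly.regime_of_brackets`. -/
def TplusFromPC0 (Δ : ℝ) : Prop :=
  ∀ lam2 : ℝ, ∀ f : Tor L → ℝ, IsTwoMagnon L Δ lam2 f →
    ∀ Qlo Qhi Plo Phi : ℝ,
      Qlo ≤ (∑ c : Cfg L, piR L f c * C0fn L Δ lam2 f c) → (∑ c : Cfg L, piR L f c * C0fn L Δ lam2 f c) ≤ Qhi →
      0 < Plo → Plo ≤ PiNormSq L f → PiNormSq L f ≤ Phi →
        3 * lam2 + min (Qlo / Plo) (Qlo / Phi) ≤ Tplus L Δ f ∧ Tplus L Δ f ≤ 3 * lam2 + max (Qhi / Plo) (Qhi / Phi)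

/-- the finer `N₁` form (optional refinement of `KT1Assembly.trialGapN1_ge_of_brackets`, same proof): keeping the product
`Q·B/P` with its 8 corners instead of `T⁻·(−B⁺)` and `T⁺⁺P⁺`:
`N₁ ≥ −ε₁B⁺ + min_{corners}(−Q·B/P) − (ε₁/2)(3λ₂P⁺ + Q⁺ + 12Δf_nn²A⁺) + B_C⁻`. -/
def N1FromPieces (Δ : ℝ) : Prop :=
  ∀ lam2 : ℝ, ∀ f : Tor L → ℝ, IsGroundTwoMagnon L Δ lam2 f → 0 < lam2 →
    ∀ Blo Bhi Plo Phi Ahi Qlo Qhi Clo : ℝ,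
      Blo ≤ Bterm L f → Bterm L f ≤ Bhi → Bhi ≤ 0 →
      0 < Plo → Plo ≤ PiNormSq L f → PiNormSq L f ≤ Phi →
      Axhat L f ≤ Ahi →
      Qlo ≤ (∑ c : Cfg L, piR L f c * C0fn L Δ lam2 f c) → (∑ c : Cfg L, piR L f c * C0fn L Δ lam2 f c) ≤ Qhi →
      Clo ≤ BCterm L Δ lam2 f →
      -(eps1 L) * Bhi
          + min (min (min (-(Qlo * Blo / Plo)) (-(Qlo * Blo / Phi))) (min (-(Qlo * Bhi / Plo)) (-(Qlo * Bhi / Phi))))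
                (min (min (-(Qhi * Blo / Plo)) (-(Qhi * Blo / Phi))) (min (-(Qhi * Bhi / Plo)) (-(Qhi * Bhi / Phi))))
          - eps1 L / 2 * (3 * lam2 * Phi + Qhi + 12 * Δ * f (K1 L) ^ 2 * Ahi) + Clo
        ≤ trialGapN1 L Δ f

end Summit.HubbardSuperconductivity.HubbardSuperconductivity.Theorems.AnisotropyChord.Transfer.Fibre3

end
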